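import Mathlib
import Summits.NavierStokesRegularity.NavierStokesRegularity.Theorems.ScenarioCensusPitchDefectColumnar
import HarnessLib

/-!
# Census row A8t, line «pitch-defect»: the radial potential of a columnar field (S3a2, part 2a)

Support file for the scenario census of `NavierStokesRegularity` (row A8t, line «pitch-defect»,
stub S3a2 «columnar swirl–axial fields are Oseen-invisible»; KEY-NS #101 (2)). Continuation of
`ScenarioCensusPitchDefectColumnar.lean`.

`Columnar.exists_potential`: for a columnar field `Z` (C¹, bounded by `M` with `‖DZ‖ ≤ L`,
divergence free, `x₃`-independent, rotation-equivariant about the `x₃`-axis) the self-convection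
is a gradient: there is a `C¹` function `Φ` (the RADIAL potential `Φ(y) = F(|y_h|)`,
`F(ρ) = ∫₀^ρ Z₂(σ e₁)²/σ dσ`, a continuous integrand bounded by `L²|σ|` and by `ML`) with
`DΦ(y) = −⟪DZ(y)[Z(y)], ·⟫` for every `y` and `|Φ(y)| ≤ M L ‖y‖` (Majda–Bertozzi 2002, §2.2.1,
Example 2.1: the self-interaction of a radial eddy is a pressure gradient). Plus the derivative of
the cylindrical radius off the axis (`hasFDerivAt_cylRadius`).
No summit statement and no census row is proved here.
-/

-- the summit and its single problem share the name (D-0017 nested layout)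
set_option linter.dupNamespace false

noncomputable section

open MeasureTheory Set Function Filter Metric intervalIntegral
open scoped Topology ENNReal NNReal RealInnerProductSpace

namespace Summit.NavierStokesRegularity.NavierStokesRegularity.Theorems.ScenarioCensus.PitchDefect

open Literature.Analysis Literature.Analysis.FluidPDE

namespace Columnar


variable {Z : EuclideanSpace ℝ (Fin 3) → EuclideanSpace ℝ (Fin 3)}

/-! ### Small coordinate facts -/

/-- The cylindrical radius is differentiable off the axis, with
`D|y_h|(v) = (y₁v₁ + y₂v₂)/|y_h|`. [folklore] -/
theorem hasFDerivAt_cylRadius {y : EuclideanSpace ℝ (Fin 3)} (hy : cylRadius y ≠ 0) :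
    HasFDerivAt (fun w : EuclideanSpace ℝ (Fin 3) => Real.sqrt (w 0 ^ 2 + w 1 ^ 2))
      ((1 / (2 * Real.sqrt (y 0 ^ 2 + y 1 ^ 2))) •
        ((2 • y 0) • (PiLp.proj 2 (fun _ : Fin 3 => ℝ) (0 : Fin 3) : EuclideanSpace ℝ (Fin 3) →L[ℝ] ℝ) +
        (2 • y 1) • (PiLp.proj 2 (fun _ : Fin 3 => ℝ) (1 : Fin 3) : EuclideanSpace ℝ (Fin 3) →L[ℝ] ℝ))) y := by
  have h0 := (PiLp.proj 2 (fun _ : Fin 3 => ℝ) (0 : Fin 3) : EuclideanSpace ℝ (Fin 3) →L[ℝ] ℝ).hasFDerivAt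
    (x := y)
  have h1 := (PiLp.proj 2 (fun _ : Fin 3 => ℝ) (1 : Fin 3) : EuclideanSpace ℝ (Fin 3) →L[ℝ] ℝ).hasFDerivAt
    (x := y)
  have hsq := (h0.pow 2).add (h1.pow 2)
  simp only [Nat.add_one_sub_one, pow_one, PiLp.proj_apply] at hsq
  have hne : y 0 ^ 2 + y 1 ^ 2 ≠ 0 := by
    intro h
    apply hy
    rw [cylRadius, h, Real.sqrt_zero]
  exact hsq.sqrt hne

/-! ### The radial potential -/

/-- **The self-convection of a columnar field is a gradient** (radial potential, see the module
docstring): `DΦ(y) = −⟪DZ(y)[Z(y)], ·⟫` with `|Φ(y)| ≤ M L ‖y‖`.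
[cite: MajdaBertozzi2002, §2.2.1 Example 2.1 (radial eddies; (v·∇)v = −∇P)] -/
theorem exists_potential {M L : ℝ} (hZ : ContDiff ℝ 1 Z) (hM : ∀ y, ‖Z y‖ ≤ M)
    (hL : ∀ y, ‖fderiv ℝ Z y‖ ≤ L) (hdiv : VectorCalculus.IsDivFree Z)
    (hz : ∀ (s : ℝ) (y : EuclideanSpace ℝ (Fin 3)), Z (y + s • EuclideanSpace.single 2 (1 : ℝ)) = Z y)
    (hrot : ∀ (θ : ℝ) (y : EuclideanSpace ℝ (Fin 3)), Z (rotZ θ y) = rotZ θ (Z y)) :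
    ∃ Φ : EuclideanSpace ℝ (Fin 3) → ℝ,
      (∀ y, HasFDerivAt Φ (-(innerSL ℝ (fderiv ℝ Z y (Z y)))) y) ∧ ∀ y, |Φ y| ≤ M * L * ‖y‖ := by
  have hZd : Differentiable ℝ Z := hZ.differentiable (by simp)
  have hZc : Continuous Z := hZ.continuous
  have hM0 : 0 ≤ M := (norm_nonneg _).trans (hM 0)
  have hL0 : 0 ≤ L := (norm_nonneg _).trans (hL 0)
  have inner_eq_three : ∀ a b : EuclideanSpace ℝ (Fin 3), ⟪a, b⟫ = a 0 * b 0 + a 1 * b 1 + a 2 * b 2 :=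
    fun a b => by simp [PiLp.inner_apply, Fin.sum_univ_three, mul_comm]
  have cylRadius_le_norm_three : ∀ v : EuclideanSpace ℝ (Fin 3), cylRadius v ≤ ‖v‖ := fun v => by
    rw [cylRadius, EuclideanSpace.norm_eq]
    apply Real.sqrt_le_sqrt
    have h : ∑ i : Fin 3, ‖v i‖ ^ 2 = v 0 ^ 2 + v 1 ^ 2 + v 2 ^ 2 := by
      simp [Fin.sum_univ_three, Real.norm_eq_abs, sq_abs]
    rw [h]
    nlinarith [sq_nonneg (v 2)]
  -- the swirl on the ray `σ ↦ Z₂(σ e₁)` and its bounds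
  set b : ℝ → ℝ := fun σ => Z (σ • EuclideanSpace.single 0 (1 : ℝ)) 1 with hb
  have hb0 : b 0 = 0 := by
    simp only [hb, zero_smul]
    exact (horizontal_eq_zero_of_axis hrot (y := 0) rfl rfl).2
  have hbL : ∀ σ, |b σ| ≤ L * |σ| := by
    intro σ
    have hmv : ‖Z (σ • EuclideanSpace.single 0 (1 : ℝ)) - Z 0‖ ≤ L * ‖σ • EuclideanSpace.single 0 (1 : ℝ) - (0 : EuclideanSpace ℝ (Fin 3))‖ :=
      (convex_univ).norm_image_sub_le_of_norm_fderiv_le (fun x _ => hZd x) (fun x _ => hL x)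
        (mem_univ _) (mem_univ _)
    have hn : ‖σ • (EuclideanSpace.single 0 (1 : ℝ) : EuclideanSpace ℝ (Fin 3)) - 0‖ = |σ| := by
      rw [sub_zero, norm_smul, Real.norm_eq_abs]; simp
    rw [hn] at hmv
    have hcomp : |b σ - Z 0 1| ≤ ‖Z (σ • EuclideanSpace.single 0 (1 : ℝ)) - Z 0‖ := by
      have := PiLp.norm_apply_le (Z (σ • EuclideanSpace.single 0 (1 : ℝ)) - Z 0) 1
      simpa [hb, Real.norm_eq_abs] using this
    have hZ01 : Z 0 1 = 0 := (horizontal_eq_zero_of_axis hrot (y := 0) rfl rfl).2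
    rw [hZ01, sub_zero] at hcomp
    exact hcomp.trans hmv
  have hbM : ∀ σ, |b σ| ≤ M := fun σ => by
    have := PiLp.norm_apply_le (Z (σ • EuclideanSpace.single 0 (1 : ℝ))) 1
    rw [Real.norm_eq_abs] at this
    exact this.trans (hM _)
  have hbc : Continuous b :=
    (continuous_apply 1).comp ((PiLp.continuous_ofLp 2 _).comp
      (hZc.comp (continuous_id.smul continuous_const)))
  -- the integrand `q σ = b σ² / σ`
  set q : ℝ → ℝ := fun σ => b σ ^ 2 / σ with hq
  have hq1 : ∀ σ, |q σ| ≤ L ^ 2 * |σ| := by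
    intro σ
    rcases eq_or_ne σ 0 with hσ | hσ
    · simp [hq, hσ]
    · rw [hq]; simp only
      rw [abs_div, abs_pow, div_le_iff₀ (abs_pos.2 hσ)]
      calc |b σ| ^ 2 ≤ (L * |σ|) ^ 2 := pow_le_pow_left₀ (abs_nonneg _) (hbL σ) 2
        _ = L ^ 2 * |σ| * |σ| := by ring
  have hq2 : ∀ σ, |q σ| ≤ M * L := by
    intro σ
    rcases eq_or_ne σ 0 with hσ | hσ
    · simp [hq, hσ]; positivity
    · rw [hq]; simp only
      rw [abs_div, abs_pow, div_le_iff₀ (abs_pos.2 hσ), pow_two]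
      calc |b σ| * |b σ| ≤ M * (L * |σ|) :=
            mul_le_mul (hbM σ) (hbL σ) (abs_nonneg _) hM0
        _ = M * L * |σ| := by ring
  have hqc : Continuous q := by
    rw [continuous_iff_continuousAt]
    intro σ
    rcases eq_or_ne σ 0 with hσ | hσ
    · -- at the origin: `|q| ≤ L²|σ| → 0`
      rw [hσ, ContinuousAt, show q 0 = 0 by simp [hq]]
      refine squeeze_zero_norm (a := fun σ => L ^ 2 * |σ|) (fun σ => ?_) ?_
      · exact (Real.norm_eq_abs _).le.trans (hq1 σ)
      · have : Tendsto (fun σ : ℝ => L ^ 2 * |σ|) (𝓝 0) (𝓝 (L ^ 2 * |0|)) :=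
          (continuous_const.mul continuous_abs).tendsto 0
        simpa using this
    · exact ((hbc.pow 2).continuousAt).div continuousAt_id hσ
  -- the profile `F ρ = ∫₀^ρ q`
  set F : ℝ → ℝ := fun ρ => ∫ σ in (0 : ℝ)..ρ, q σ with hF
  have hFd : ∀ ρ, HasDerivAt F (q ρ) ρ := fun ρ =>
    intervalIntegral.integral_hasDerivAt_right (hqc.intervalIntegrable _ _)
      (hqc.stronglyMeasurableAtFilter _ _) hqc.continuousAt
  have hF1 : ∀ ρ, |F ρ| ≤ M * L * |ρ| := by
    intro ρ
    have h := intervalIntegral.norm_integral_le_of_norm_le_const (a := 0) (b := ρ) (f := q)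
      (C := M * L) fun σ _ => (Real.norm_eq_abs _).le.trans (hq2 σ)
    rw [sub_zero, Real.norm_eq_abs] at h
    exact h
  have hF2 : ∀ ρ, |F ρ| ≤ L ^ 2 * |ρ| * |ρ| := by
    intro ρ
    have h := intervalIntegral.norm_integral_le_of_norm_le_const (a := 0) (b := ρ) (f := q)
      (C := L ^ 2 * |ρ|) fun σ hσ => by
        refine (Real.norm_eq_abs _).le.trans ((hq1 σ).trans ?_)
        refine mul_le_mul_of_nonneg_left ?_ (sq_nonneg L)
        rcases le_or_gt 0 ρ with hρ | hρ
        · rw [Set.uIoc_of_le hρ] at hσ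
          rw [abs_of_pos hσ.1, abs_of_nonneg hρ]; exact hσ.2
        · rw [Set.uIoc_of_ge hρ.le] at hσ
          rw [abs_of_nonpos hσ.2, abs_of_neg hρ]; linarith [hσ.1]
    rw [sub_zero, Real.norm_eq_abs] at h
    exact h
  -- the potential
  refine ⟨fun y => F (cylRadius y), fun y => ?_, fun y => ?_⟩
  · rcases eq_or_ne (cylRadius y) 0 with hy | hy
    · -- on the axis: `DΦ = 0 = −⟪DZ[Z], ·⟫`
      rw [convect_axis hZd hz hrot hy, map_zero, neg_zero]
      obtain ⟨hy0, hy1⟩ := (cylRadius_eq_zero_iff y).1 hy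
      rw [hasFDerivAt_iff_isLittleO_nhds_zero]
      refine Asymptotics.isLittleO_iff.2 fun c hc => ?_
      have hball : Metric.ball (0 : EuclideanSpace ℝ (Fin 3)) (c / (L ^ 2 + 1)) ∈ 𝓝 (0 : EuclideanSpace ℝ (Fin 3)) :=
        Metric.ball_mem_nhds _ (by positivity)
      filter_upwards [hball] with w hw
      rw [Metric.mem_ball, dist_zero_right] at hw
      have hrad : cylRadius (y + w) = cylRadius w := by
        simp [cylRadius, hy0, hy1]
      have hF0 : F (cylRadius y) = 0 := by rw [hy]; simp [hF]
      have hz0 : (0 : EuclideanSpace ℝ (Fin 3) →L[ℝ] ℝ) w = 0 := rfl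
      rw [hz0, hrad, hF0, sub_zero, sub_zero, Real.norm_eq_abs]
      have hcw : |cylRadius w| ≤ ‖w‖ := by
        rw [abs_of_nonneg (cylRadius_nonneg w)]; exact cylRadius_le_norm_three w
      calc |F (cylRadius w)| ≤ L ^ 2 * |cylRadius w| * |cylRadius w| := hF2 _
        _ ≤ L ^ 2 * ‖w‖ * ‖w‖ := by gcongr
        _ = (L ^ 2 * ‖w‖) * ‖w‖ := by ring
        _ ≤ c * ‖w‖ := by
            refine mul_le_mul_of_nonneg_right ?_ (norm_nonneg _)
            have h1 : L ^ 2 * ‖w‖ ≤ L ^ 2 * (c / (L ^ 2 + 1)) :=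
              mul_le_mul_of_nonneg_left hw.le (sq_nonneg L)
            have h2 : L ^ 2 * (c / (L ^ 2 + 1)) ≤ c := by
              rw [mul_div_assoc']
              rw [div_le_iff₀ (by positivity)]
              nlinarith [sq_nonneg L]
            exact h1.trans h2
    · -- off the axis: chain rule and the explicit formula for `DZ[Z]`
      have hchain : HasFDerivAt (fun w : EuclideanSpace ℝ (Fin 3) => F (cylRadius w)) _ y :=
        (hFd (cylRadius y)).comp_hasFDerivAt y (hasFDerivAt_cylRadius hy)
      refine hchain.congr_fderiv ?_
      rw [convect_formula hZd hdiv hz hrot hy]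
      ext v
      have hr2 : cylRadius y ^ 2 = y 0 ^ 2 + y 1 ^ 2 := cylRadius_sq y
      have hr : cylRadius y = Real.sqrt (y 0 ^ 2 + y 1 ^ 2) := rfl
      have hsq0 : Real.sqrt (y 0 ^ 2 + y 1 ^ 2) ≠ 0 := hr ▸ hy
      simp [inner_eq_three, hq, hb, PiLp.proj_apply, smul_eq_mul]
      rw [hr]
      field_simp
  · calc |F (cylRadius y)| ≤ M * L * |cylRadius y| := hF1 _
      _ ≤ M * L * ‖y‖ := by
          rw [abs_of_nonneg (cylRadius_nonneg y)]
          exact mul_le_mul_of_nonneg_left (cylRadius_le_norm_three y) (mul_nonneg hM0 hL0)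

end Columnar

end Summit.NavierStokesRegularity.NavierStokesRegularity.Theorems.ScenarioCensus.PitchDefect

end
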